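import Summits.QuantumFields.BalabanUV.T4Continuum.Support.ShellMeasureWindowCovariant
import Literature.MathematicalPhysics.QuantumFieldTheory.Balaban1983to89.AveragingRT

/-!
# `T4Continuum.ShellMeasureWindowCovariantAxial` — THE KERNEL INSTANCE of `ShellMeasureWindowCovariant` on the
# tree's own objects: product Haar `dU` on the fields of `T^{(j)}` DISINTEGRATES along the AXIAL (decimation) average
# `AveragingRT.axialAvg` as (unit-fibre law) ⊗ `dV` through right translation of the last bond of every line; the
# unit fibre is the graph «last bond = (product of the other bonds of the line)⁻¹»; (M1) for a `dU`-realized slot law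
# windowed about a covariant section of the axial average ⇐ (M1) on the unit fibre with a FIXED-centre ball
(cell `pub-balaban`, sub-cell `t4`, spine estimate NE7c (node U5b); NE7c ROUND-2 crew `t4-ne7c-formalise-*`, seat
leaf-10 (gen 4), sibling of `ShellMeasureWindowCovariant` (this seat, same gen); ADDITIVE — imports that file and
`AveragingRT` only, modifies nothing, re-proves nothing of `AveragingRT` (its `axialAvg_mul_last`,
`measurePreserving_mulRight`, `measurable_pathProd`, `last_injective` are used BY NAME); 0 `def`, 0 sorry, 0 cite)

HONEST FRAMING.  Finite four-torus programme, rung (B)+1 only — NOT infinite volume, NOT a mass gap, NOT the Clay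
problem, NOT summit progress; (B), `BetaPertHyp`, (B^μ) are not consumed.  NE7c ⇐ the named binders (trigger c3);
NE7c NOT PRINTED, NOT proved; spine PROVED 0/9 before and after.  The axial average is the tree's INHABITANT of the
averaging axioms (`AveragingRT` header: NOT the weighted block average B7 (15) = B12 (0.12) of the series, DIVERGENCE
F6); this file shows that the translation structure (T) of the sibling file is NON-VACUOUS on `GaugeField P j G` with
product Haar and computes its unit fibre — it does NOT claim (T) for [Balaban1985Averaging]'s block average.
STRUCTURAL BOOKKEEPING — no estimate, no `def` (c2), `[folklore]` throughout.  HONEST DEPENDENCY (cell): continuum YM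
on T⁴ ⇐ BetaPertH ∧ nine spine estimates (0/9 proved); BetaPertH ⇐ (D1) ∧ (D4) ∧ CAP+tail; G-an2-4 gates asym, D1 and
NE2/3/4.

THE INSTANCE (standing range `j + 1 ≤ m + K`, the range in which `AveragingRT` proves anything about lines).  Value
group `B := PBond P (j+1) → G` (coarse fields, pointwise group law — the type `GaugeField P (j+1) G` unfolded so that
Mathlib's `Pi` instances apply), Haar probability `η := Measure.pi (fun _ => haar)`, which IS `fieldMeasure P (j+1) G`
(`dV`) by `rfl` (`fieldMeasure_eq_pi`), left-invariant by Mathlib's `Measure.pi.isMulLeftInvariant`; configuration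
space `X := GaugeField P j G` with `μ := fieldMeasure P j G` (`dU`); the ACTION `act g U := (b ↦ U b · k_g b)` with
`k_g := Function.extend (c ↦ line c (L−1)) g 1` — right-multiply the LAST bond of the line of every coarse bond `c`
by `g c`, all other bonds untouched (`dU`-preserving by `AveragingRT.measurePreserving_mulRight`); the AVERAGE
`M := axialAvg`, covariant by `AveragingRT.axialAvg_mul_last` (`Ū(U · k_g) = Ū(U) · g`).
* §1 `extend_last_one`/`_mul`/`_inv` (the last-bond extension is a group homomorphism — `last_injective`),
  `lastAct_one`/`lastAct_mul`/`axialAvg_lastAct` ((T)'s three algebraic laws), `quotient_lastAct` (print's window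
  variable `U(b)·C(b)⁻¹` is INVARIANT under the action applied to field and centre), `measurable_lastAct`,
  `measurable_axialAvg_pi`, `measurePreserving_lastAct`, `isMulLeftInvariant_haar`, `fieldMeasure_eq_pi` (`dV` IS
  `Measure.pi (fun _ => haar)` on `PBond P (j+1) → G`, `rfl` — the form in which the statements are written);
* §2 `normalise_last`/`normalise_offLast` — THE UNIT FIBRE: the normalisation `W U = U · k_{Ū(U)⁻¹}` replaces the last
  bond variable of each line by `(U(b₀)⋯U(b_{L−2}))⁻¹` and keeps every other bond: `{Ū = 1}` is the GRAPH of
  «last bond = (prefix transport)⁻¹» over the remaining bond variables (the chart (CH)_fib of the sibling header is,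
  here, the remaining bonds themselves);
* §3 `map_normalise_axialAvg_eq_prod` (`dU`-law of `(W U, Ū)` = `(dU.map W) ⊗ dV`: the normalised field and the
  axial average are INDEPENDENT and `Ū ∼ dV`), `measurePreserving_translate_axialAvg` (`(w, V) ↦ w · k_V` pushes
  `(dU.map W) ⊗ dV` to `dU` — every fibre `{Ū = V}` is the last-bond translate of the unit fibre), and an `example`
  re-deriving `AveragingRT.map_axialAvg` (`dU.map Ū = dV`) from the sibling's `map_average` — consistency in kernel,
  the tree's theorem is neither restated nor replaced;
* §4 `slotAC_axial_of_fibrewise` ((M1) for a `dU`-realized slot law `((dU.prod ζ).withDensity G)` ⇐ (M1) on the unit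
  fibre per (exterior point, coarse field)), **`slotAC_axialWindow_of_fibrewise`** — the window
  `1{δ(b ↦ U b · (centre b)⁻¹) < r}` for ANY measurable gauge `δ` of the bondwise quotients (the SHAPE of
  [Balaban1989LargeFieldI] (1.27): `|V_j(b) V^{(j)}(b)⁻¹ − 1|` bondwise — READING, G-ne7cL10-1) about the COVARIANT
  centre `c_z · k_{Ū(U)}` is, on the unit fibre, the FIXED ball
  `1{δ(b ↦ w b · (c_z b)⁻¹) < r}` for every coarse field: (M1) for the windowed realized law ⇐ (M1) on the unit fibre
  with that fixed co-test, per `(z, V)`, SAME `θ ρ D`.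
Nothing printed is asserted; no instance of SM-L1/L3/L4/L6 at any `j ≥ 1`; (M1) per slot stays THE wall.
-/

noncomputable section

open Set Function MeasureTheory MeasureTheory.Measure

namespace Summit.QuantumFields.BalabanUV.T4Continuum.ShellMeasureWindowCovariantAxial

open scoped ENNReal
open Literature.MathematicalPhysics.QuantumFieldTheory.Balaban1983to89
open T4ShellMeasure (SlotAntiConcentration)
open AveragingRT (line pathProd axialAvg last_injective axialAvg_mul_last measurable_axialAvg
  measurePreserving_mulRight measurable_pathProd)
open ShellMeasureWindowCovariant (map_average map_normalise_average_eq_prod measurePreserving_translate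
  slotAC_covariant_of_fibrewise slotAC_covariantWindow_of_fibrewise)

variable {P : Params} {j : ℕ} {G : Type*} [GaugeGroup G]

/-! ## §1 The last-bond translation: algebra, measurability, invariance of `dU` -/

section Algebra

/-- the last-bond extension of the unit coarse field is the unit field. [folklore] -/
theorem extend_last_one (b : PBond P j) :
    Function.extend (fun c : PBond P (j+1) => line c (P.L - 1)) (1 : PBond P (j+1) → G) (fun _ => 1) b = 1 := by
  classical
  rw [Function.extend_def]
  split <;> rfl

/-- the last-bond extension is multiplicative (standing range: the last bonds of distinct lines are distinct).
[folklore] -/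
theorem extend_last_mul (hj : j + 1 ≤ P.m + P.K) (g h : PBond P (j+1) → G) (b : PBond P j) :
    Function.extend (fun c : PBond P (j+1) => line c (P.L - 1)) (g * h) (fun _ => 1) b =
      Function.extend (fun c : PBond P (j+1) => line c (P.L - 1)) g (fun _ => 1) b *
        Function.extend (fun c : PBond P (j+1) => line c (P.L - 1)) h (fun _ => 1) b := by
  by_cases hb : ∃ c, line c (P.L - 1) = b
  · obtain ⟨c, rfl⟩ := hb
    rw [(last_injective hj).extend_apply, (last_injective hj).extend_apply, (last_injective hj).extend_apply,
      Pi.mul_apply]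
  · rw [Function.extend_apply' _ _ _ hb, Function.extend_apply' _ _ _ hb, Function.extend_apply' _ _ _ hb, mul_one]

/-- the last-bond extension commutes with inversion. [folklore] -/
theorem extend_last_inv (hj : j + 1 ≤ P.m + P.K) (g : PBond P (j+1) → G) (b : PBond P j) :
    Function.extend (fun c : PBond P (j+1) => line c (P.L - 1)) g⁻¹ (fun _ => 1) b =
      (Function.extend (fun c : PBond P (j+1) => line c (P.L - 1)) g (fun _ => 1) b)⁻¹ := by
  by_cases hb : ∃ c, line c (P.L - 1) = b
  · obtain ⟨c, rfl⟩ := hb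
    rw [(last_injective hj).extend_apply, (last_injective hj).extend_apply, Pi.inv_apply]
  · rw [Function.extend_apply' _ _ _ hb, Function.extend_apply' _ _ _ hb, inv_one]

/-- (T), law 1: the unit coarse field acts trivially. [folklore] -/
theorem lastAct_one (U : GaugeField P j G) :
    (fun b => U b * Function.extend (fun c : PBond P (j+1) => line c (P.L - 1)) (1 : PBond P (j+1) → G)
      (fun _ => 1) b) = U := by
  funext b
  rw [extend_last_one, mul_one]

/-- (T), law 2: a right action — `act (g h) = act h ∘ act g`. [folklore] -/
theorem lastAct_mul (hj : j + 1 ≤ P.m + P.K) (g h : PBond P (j+1) → G) (U : GaugeField P j G) :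
    (fun b => U b * Function.extend (fun c : PBond P (j+1) => line c (P.L - 1)) (g * h) (fun _ => 1) b) =
      fun b => (U b * Function.extend (fun c : PBond P (j+1) => line c (P.L - 1)) g (fun _ => 1) b) *
        Function.extend (fun c : PBond P (j+1) => line c (P.L - 1)) h (fun _ => 1) b := by
  funext b
  rw [extend_last_mul hj, mul_assoc]

/-- (T), law 3 — COVARIANCE: `Ū(U · k_g) = Ū(U) · g` (`AveragingRT.axialAvg_mul_last` BY NAME, restated at the
unfolded type of coarse fields). [folklore] -/
theorem axialAvg_lastAct (hj : j + 1 ≤ P.m + P.K) (g : PBond P (j+1) → G) (U : GaugeField P j G) :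
    (fun c => axialAvg (fun b => U b * Function.extend (fun c : PBond P (j+1) => line c (P.L - 1)) g (fun _ => 1) b)
      c) = (fun c => axialAvg U c) * g :=
  axialAvg_mul_last hj U g

/-- print's window variable, the bondwise quotient `U(b)·C(b)⁻¹` of the field by the centre, is INVARIANT under the
last-bond action applied to both. [folklore] -/
theorem quotient_lastAct (g : PBond P (j+1) → G) (U C : GaugeField P j G) :
    (fun b => (U b * Function.extend (fun c : PBond P (j+1) => line c (P.L - 1)) g (fun _ => 1) b) *
      (C b * Function.extend (fun c : PBond P (j+1) => line c (P.L - 1)) g (fun _ => 1) b)⁻¹) =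
      fun b => U b * (C b)⁻¹ := by
  funext b
  rw [mul_inv_rev, ← mul_assoc, mul_inv_cancel_right]

end Algebra

section Measure

variable [MeasurableSpace G] [MeasurableMul₂ G]

/-- the action is jointly measurable in (coarse field, field). [folklore] -/
theorem measurable_lastAct (hj : j + 1 ≤ P.m + P.K) :
    Measurable fun p : (PBond P (j+1) → G) × GaugeField P j G =>
      (fun b => p.2 b * Function.extend (fun c : PBond P (j+1) => line c (P.L - 1)) p.1 (fun _ => 1) b) := by
  refine measurable_pi_iff.mpr fun b => ?_
  have h2 : Measurable fun p : (PBond P (j+1) → G) × GaugeField P j G => p.2 b :=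
    (measurable_pi_apply b).comp measurable_snd
  by_cases hb : ∃ c, line c (P.L - 1) = b
  · obtain ⟨c, rfl⟩ := hb
    have h1 : Measurable fun p : (PBond P (j+1) → G) × GaugeField P j G => p.1 c :=
      (measurable_pi_apply c).comp measurable_fst
    simp_rw [(last_injective hj).extend_apply]
    exact h2.mul h1
  · simp_rw [Function.extend_apply' _ _ _ hb]
    exact h2.mul measurable_const

/-- the axial average is measurable, at the unfolded type of coarse fields (`AveragingRT.measurable_pathProd`).
[folklore] -/
theorem measurable_axialAvg_pi :
    Measurable fun (U : GaugeField P j G) (c : PBond P (j+1)) => axialAvg U c :=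
  measurable_pi_iff.mpr fun c => measurable_pathProd c P.L

variable [HaarData G]

/-- the action preserves `dU` (right-invariance of Haar, bondwise — `AveragingRT.measurePreserving_mulRight`).
[folklore] -/
theorem measurePreserving_lastAct (g : PBond P (j+1) → G) :
    MeasurePreserving (fun (U : GaugeField P j G) (b : PBond P j) =>
      U b * Function.extend (fun c : PBond P (j+1) => line c (P.L - 1)) g (fun _ => 1) b)
      (fieldMeasure P j G) (fieldMeasure P j G) :=
  measurePreserving_mulRight _



end Measure

section Haar

variable [MeasurableSpace G] [HaarData G]

/-- the Haar datum is left-invariant (field `HaarData.map_mul_left`, as Mathlib's class). [folklore] -/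
theorem isMulLeftInvariant_haar : (HaarData.haar : Measure G).IsMulLeftInvariant :=
  ⟨HaarData.map_mul_left⟩

/-- `dV = fieldMeasure P (j+1) G` IS the product Haar measure `Measure.pi (fun _ => haar)` on coarse fields
`PBond P (j+1) → G` — by definition (`rfl`); the statements below are written with the right-hand side so that
Mathlib's `Pi` instances (group law, measurability of the multiplication, left-invariance
`MeasureTheory.Measure.pi.isMulLeftInvariant`, probability) apply verbatim to the value group of the average.
[folklore] -/
theorem fieldMeasure_eq_pi :
    fieldMeasure P (j+1) G = Measure.pi (fun _ : PBond P (j+1) => (HaarData.haar : Measure G)) :=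
  rfl

end Haar

/-! ## §2 The unit fibre of the axial average: a graph over the non-last bond variables -/

section UnitFibre

/-- **THE NORMALISATION ON A LAST BOND.**  `W U := U · k_{Ū(U)⁻¹}` replaces the last bond variable of the line of `c` by
the inverse `(U(b₀) ⋯ U(b_{L−2}))⁻¹` of the transport along the first `L − 1` bonds: on the unit fibre the last bond
is READ OFF the others. [folklore] -/
theorem normalise_last (hj : j + 1 ≤ P.m + P.K) (U : GaugeField P j G) (c : PBond P (j+1)) :
    U (line c (P.L - 1)) * Function.extend (fun c : PBond P (j+1) => line c (P.L - 1))
      (fun c => axialAvg U c)⁻¹ (fun _ => 1) (line c (P.L - 1)) = (pathProd U c (P.L - 1))⁻¹ := by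
  rw [(last_injective hj).extend_apply, Pi.inv_apply]
  show U (line c (P.L - 1)) * (axialAvg U c)⁻¹ = _
  have hL : P.L = P.L - 1 + 1 := by have := P.hL.2; omega
  have hav : axialAvg U c = pathProd U c (P.L - 1) * U (line c (P.L - 1)) := by
    show pathProd U c P.L = _
    conv_lhs => rw [hL]
    rfl
  rw [hav, mul_inv_rev, mul_inv_cancel_left]

/-- off the last bonds the normalisation changes nothing. [folklore] -/
theorem normalise_offLast (U : GaugeField P j G) (g : PBond P (j+1) → G) {b : PBond P j}
    (hb : ¬∃ c, line c (P.L - 1) = b) :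
    U b * Function.extend (fun c : PBond P (j+1) => line c (P.L - 1)) g (fun _ => 1) b = U b := by
  rw [Function.extend_apply' _ _ _ hb, mul_one]

end UnitFibre

/-! ## §3 The disintegration of `dU` along the axial average -/

section Disintegration

variable [MeasurableSpace G] [MeasurableMul₂ G] [MeasurableInv G] [HaarData G]

/-- **`dU`-LAW OF (NORMALISED FIELD, AXIAL AVERAGE) = (unit-fibre law) ⊗ `dV`** — the normalised field and the axial
average are independent and the average is `dV`-distributed (standing range). [folklore] -/
theorem map_normalise_axialAvg_eq_prod (hj : j + 1 ≤ P.m + P.K) :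
    (fieldMeasure P j G).map (fun U : GaugeField P j G =>
      ((fun b => U b * Function.extend (fun c : PBond P (j+1) => line c (P.L - 1))
        (fun c => axialAvg U c)⁻¹ (fun _ => 1) b : GaugeField P j G), fun c => axialAvg U c)) =
      ((fieldMeasure P j G).map fun U : GaugeField P j G =>
        (fun b => U b * Function.extend (fun c : PBond P (j+1) => line c (P.L - 1))
          (fun c => axialAvg U c)⁻¹ (fun _ => 1) b : GaugeField P j G)).prod
      (Measure.pi (fun _ : PBond P (j+1) => (HaarData.haar : Measure G))) := by
  haveI := isMulLeftInvariant_haar (G := G)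
  exact map_normalise_average_eq_prod (B := PBond P (j+1) → G)
    (Measure.pi (fun _ : PBond P (j+1) => (HaarData.haar : Measure G))) (fieldMeasure P j G)
    (act := fun (g : PBond P (j+1) → G) (U : GaugeField P j G) (b : PBond P j) =>
      U b * Function.extend (fun c : PBond P (j+1) => line c (P.L - 1)) g (fun _ => 1) b)
    (M := fun (U : GaugeField P j G) (c : PBond P (j+1)) => axialAvg U c)
    (measurable_lastAct hj) (lastAct_mul hj) measurePreserving_lastAct measurable_axialAvg_pi (axialAvg_lastAct hj)

/-- **`dU` DISINTEGRATES ALONG THE AXIAL AVERAGE THROUGH THE LAST-BOND TRANSLATES**: `(w, V) ↦ w · k_V` pushes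
(unit-fibre law) ⊗ `dV` to `dU`; the fibre `{Ū = V}` is the translate of the unit fibre and carries the translate of
its law — no conditional measure (compare the a.e.-defined `T4AveragingDisintegration.condLaw`). [folklore] -/
theorem measurePreserving_translate_axialAvg (hj : j + 1 ≤ P.m + P.K) :
    MeasurePreserving (fun p : GaugeField P j G × (PBond P (j+1) → G) =>
      (fun b => p.1 b * Function.extend (fun c : PBond P (j+1) => line c (P.L - 1)) p.2 (fun _ => 1) b :
        GaugeField P j G))
      (((fieldMeasure P j G).map fun U : GaugeField P j G =>
        (fun b => U b * Function.extend (fun c : PBond P (j+1) => line c (P.L - 1))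
          (fun c => axialAvg U c)⁻¹ (fun _ => 1) b : GaugeField P j G)).prod
        (Measure.pi (fun _ : PBond P (j+1) => (HaarData.haar : Measure G))))
      (fieldMeasure P j G) := by
  haveI := isMulLeftInvariant_haar (G := G)
  exact measurePreserving_translate (B := PBond P (j+1) → G)
    (Measure.pi (fun _ : PBond P (j+1) => (HaarData.haar : Measure G))) (fieldMeasure P j G)
    (act := fun (g : PBond P (j+1) → G) (U : GaugeField P j G) (b : PBond P j) =>
      U b * Function.extend (fun c : PBond P (j+1) => line c (P.L - 1)) g (fun _ => 1) b)
    (M := fun (U : GaugeField P j G) (c : PBond P (j+1)) => axialAvg U c)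
    (measurable_lastAct hj) lastAct_one (lastAct_mul hj) measurePreserving_lastAct measurable_axialAvg_pi
    (axialAvg_lastAct hj)

/-- CONSISTENCY IN KERNEL: the sibling's `map_average` re-derives the tree's Haar compatibility of the axial average,
`AveragingRT.map_axialAvg` (`dU.map Ū = dV`) — neither restated as a theorem nor replaced. [folklore] -/
example (hj : j + 1 ≤ P.m + P.K) :
    (fieldMeasure P j G).map (fun (U : GaugeField P j G) (c : PBond P (j+1)) => axialAvg U c) =
      (Measure.pi (fun _ : PBond P (j+1) => (HaarData.haar : Measure G))) := by
  haveI := isMulLeftInvariant_haar (G := G)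
  have h := map_average (B := PBond P (j+1) → G)
    (Measure.pi (fun _ : PBond P (j+1) => (HaarData.haar : Measure G))) (fieldMeasure P j G)
    (act := fun (g : PBond P (j+1) → G) (U : GaugeField P j G) (b : PBond P j) =>
      U b * Function.extend (fun c : PBond P (j+1) => line c (P.L - 1)) g (fun _ => 1) b)
    (M := fun (U : GaugeField P j G) (c : PBond P (j+1)) => axialAvg U c)
    (measurable_lastAct hj) (lastAct_mul hj) measurePreserving_lastAct measurable_axialAvg_pi (axialAvg_lastAct hj)
  rw [measure_univ, one_smul] at h
  exact h

end Disintegration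

/-! ## §4 (M1) for `dU`-realized slot laws, fibrewise along the axial average -/

section AntiConcentration

variable [MeasurableSpace G] [MeasurableMul₂ G] [MeasurableInv G] [HaarData G]

/-- **(M1) FIBREWISE ALONG THE AXIAL AVERAGE.**  A `dU`-realized slot law `((dU.prod ζ).withDensity G)` (ANY s-finite
exterior law `ζ`, measurable density `G`, measurable tested variable `u`) satisfies (M1) as soon as, for every
exterior point `z` and every coarse field `V`, the unit-fibre law tilted by `w ↦ G (w · k_V, z)` does (variable
`w ↦ u (w · k_V, z)`, SAME `θ ρ D`) — the sibling's `slotAC_covariant_of_fibrewise` at the instance. [folklore] -/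
theorem slotAC_axial_of_fibrewise (hj : j + 1 ≤ P.m + P.K) {Z : Type*} [MeasurableSpace Z] (ζ : Measure Z)
    [SFinite ζ] {G₁ : GaugeField P j G × Z → ℝ≥0∞} (hG₁ : Measurable G₁) {u : GaugeField P j G × Z → ℝ}
    (hu : Measurable u) {θ ρ D : ℝ}
    (h : ∀ (z : Z) (V : PBond P (j+1) → G), SlotAntiConcentration
      (((fieldMeasure P j G).map fun U : GaugeField P j G =>
        (fun b => U b * Function.extend (fun c : PBond P (j+1) => line c (P.L - 1))
          (fun c => axialAvg U c)⁻¹ (fun _ => 1) b : GaugeField P j G)).withDensity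
        fun w => G₁ ((fun b => w b * Function.extend (fun c : PBond P (j+1) => line c (P.L - 1)) V (fun _ => 1) b),
          z))
      (fun w => u ((fun b => w b * Function.extend (fun c : PBond P (j+1) => line c (P.L - 1)) V (fun _ => 1) b),
        z)) θ ρ D) :
    SlotAntiConcentration (((fieldMeasure P j G).prod ζ).withDensity G₁) u θ ρ D := by
  haveI := isMulLeftInvariant_haar (G := G)
  exact slotAC_covariant_of_fibrewise (B := PBond P (j+1) → G) (fieldMeasure P j G)
    (Measure.pi (fun _ : PBond P (j+1) => (HaarData.haar : Measure G))) ζ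
    (act := fun (g : PBond P (j+1) → G) (U : GaugeField P j G) (b : PBond P j) =>
      U b * Function.extend (fun c : PBond P (j+1) => line c (P.L - 1)) g (fun _ => 1) b)
    (M := fun (U : GaugeField P j G) (c : PBond P (j+1)) => axialAvg U c)
    (measurable_lastAct hj) lastAct_one (lastAct_mul hj) measurePreserving_lastAct measurable_axialAvg_pi
    (axialAvg_lastAct hj) hG₁ hu h

/-- **END — THE AXIAL INSTANCE OF (LR)_j IN THE MARGINAL READING.**  Realized slot law: `dU` × ANY s-finite exterior
law, density = window `1{δ(b ↦ U b · (centre b)⁻¹) < r}` — ANY measurable gauge `δ` of the bondwise quotients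
(print's (1.27) has `sup_b |·−1|`-shape: READING) — about the COVARIANT centre `c_z · k_{Ū(U)}` («a fixed unit-fibre
configuration `c_z` translated to the fibre of the field's own axial average»: the axial shape of (1.26)'s
`M^j`-of-a-covariant-background — READING), times weights `G₀`.  (M1) for it FOLLOWS from (M1), per `(z, V)`, of the
unit-fibre law tilted by the FIXED ball `1{δ(b ↦ w b · (c_z b)⁻¹) < r}` times `G₀ (w · k_V, z)` — SAME `θ ρ D`; the
moving centre costs NOTHING.  CONDITIONAL on the per-fibre (M1) (E2′'s level data on the unit fibre = the non-last
bond variables, §2); nothing printed is asserted. [folklore] -/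
theorem slotAC_axialWindow_of_fibrewise [MeasurableSingletonClass G] (hj : j + 1 ≤ P.m + P.K) {Z : Type*}
    [MeasurableSpace Z] (ζ : Measure Z) [SFinite ζ] {δ : GaugeField P j G → ℝ} (hδ : Measurable δ)
    {c : Z → GaugeField P j G} (hc : Measurable c) (r : ℝ) {G₀ : GaugeField P j G × Z → ℝ≥0∞}
    (hG₀ : Measurable G₀) {u : GaugeField P j G × Z → ℝ} (hu : Measurable u) {θ ρ D : ℝ}
    (h : ∀ (z : Z) (V : PBond P (j+1) → G), SlotAntiConcentration
      (((fieldMeasure P j G).map fun U : GaugeField P j G =>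
        (fun b => U b * Function.extend (fun c : PBond P (j+1) => line c (P.L - 1))
          (fun c => axialAvg U c)⁻¹ (fun _ => 1) b : GaugeField P j G)).withDensity
        fun w => {v : GaugeField P j G | δ (fun b => v b * (c z b)⁻¹) < r}.indicator 1 w *
          G₀ ((fun b => w b * Function.extend (fun c : PBond P (j+1) => line c (P.L - 1)) V (fun _ => 1) b), z))
      (fun w => u ((fun b => w b * Function.extend (fun c : PBond P (j+1) => line c (P.L - 1)) V (fun _ => 1) b),
        z)) θ ρ D) :
    SlotAntiConcentration (((fieldMeasure P j G).prod ζ).withDensity fun p =>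
      {U : GaugeField P j G | δ (fun b => U b * (c p.2 b * Function.extend (fun c : PBond P (j+1) => line c (P.L - 1))
        (fun c => axialAvg U c) (fun _ => 1) b)⁻¹) < r}.indicator 1 p.1 * G₀ p) u θ ρ D := by
  haveI := isMulLeftInvariant_haar (G := G)
  have hd : ∀ (g : PBond P (j+1) → G) (x y : GaugeField P j G),
      δ (fun b => (x b * Function.extend (fun c : PBond P (j+1) => line c (P.L - 1)) g (fun _ => 1) b) *
        (y b * Function.extend (fun c : PBond P (j+1) => line c (P.L - 1)) g (fun _ => 1) b)⁻¹) =
      δ (fun b => x b * (y b)⁻¹) := fun g x y => by rw [quotient_lastAct]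
  have hdm : Measurable fun p : GaugeField P j G × GaugeField P j G => δ (fun b => p.1 b * (p.2 b)⁻¹) :=
    hδ.comp (measurable_pi_iff.mpr fun b =>
      ((measurable_pi_apply b).comp measurable_fst).mul ((measurable_pi_apply b).comp measurable_snd).inv)
  exact slotAC_covariantWindow_of_fibrewise (B := PBond P (j+1) → G) (fieldMeasure P j G)
    (Measure.pi (fun _ : PBond P (j+1) => (HaarData.haar : Measure G))) ζ
    (act := fun (g : PBond P (j+1) → G) (U : GaugeField P j G) (b : PBond P j) =>
      U b * Function.extend (fun c : PBond P (j+1) => line c (P.L - 1)) g (fun _ => 1) b)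
    (M := fun (U : GaugeField P j G) (c : PBond P (j+1)) => axialAvg U c)
    (measurable_lastAct hj) lastAct_one (lastAct_mul hj) measurePreserving_lastAct measurable_axialAvg_pi
    (axialAvg_lastAct hj) (d := fun x y : GaugeField P j G => δ (fun b => x b * (y b)⁻¹)) hd hdm hc r hG₀ hu h

end AntiConcentration

end Summit.QuantumFields.BalabanUV.T4Continuum.ShellMeasureWindowCovariantAxial

end
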